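import Literature.IUT.HodgeArakelov.ThetaSettingDeltaCharacteristic
import Literature.AnabelianGeometry.AbsoluteAnabelian.FundamentalExtensionProSigmaGeomModel
import Literature.AnabelianGeometry.AbsoluteAnabelian.AbsTopIProp23PuncturedSurfaceModelProofs
import Mathlib.RingTheory.RootsOfUnity.Complex
import HarnessLib

/-!
# [IUTchII] Ex 1.8: the output interface `AbsTopMonoids S` INHABITED at a setting with PROFINITE `Π`,
# NONTRIVIAL free pro-`Σ` `Δ` and genuine `G_k = G_{ℚ_p}` — non-vacuity certificate

S. Mochizuki, *Inter-universal Teichmüller theory II*, §1, Example 1.8 (kurims pp. 35–41)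
[claim: Mochizuki2012, status: disputed].  abc-iut cell NON-VACUITY CERTIFICATE (referee protocol) for
abc-iut-L6-t1's interface `Literature.IUT.HodgeArakelov.AbsTopMonoids S` over a `ThetaSetting`:
abc-iut-w5-d114's `AbsTopMonoids.nonempty_iff` isolates the inhabitation condition (H1) «`Δ ⊆ Π`
characteristic» ∧ (H2) «`Π/Δ ≅ G_k`»; `ThetaSetting.nonempty_absTopMonoids_of_fundamentalExtension`
(abc-iut-w5-d206, [AbsTopI] Thm 2.6 (iv) with elasticity of `G_k` PROVED) discharges both at every
profinite MLF-based model with tfg pro-`Σ` `Δ`, `Σ ⊊ Primes`.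

THIS PROOF-ONLY FILE (no definitions, no named facts) exhibits such a setting: for all admissible
`(l, p)` (odd primes, `p ≠ l`) there is `S : ThetaSetting` with `S.l = l`, `S.p = p`,
`k := ℂ` (a characteristic-zero field containing a primitive `4l`-th root of unity, as the bare record
demands — the toy choice of `DihedralCuspToy.dSetting`),
`Π := Δ × G_{ℚ_p} ↠ G_{ℚ_p}` PROFINITE with `Δ` a pro-`{2}` completion of the free group `Γ_{0,3} ≅ F₂`
(abc-iut-w5-d206's product model `FundamentalExtension.exists_mlfBase_proSigma_model`), hence
`Δ ≠ 1`, `Δ` slim, elastic and topologically finitely generated ([AbsTopI] Prop 2.2 / 2.3 (i) at the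
affine model), `G_k` infinite — and `AbsTopMonoids S` NONEMPTY.

HONEST LABEL: a GROUP-THEORETIC model (trivial outer action; `Π` is not the tempered — nor the
profinite — fundamental group of the curve `X̲̲_k` of print, and the record's bare field `k := ℂ` is not tied
to `G_k = G_{ℚ_p}`); the inhabitant is w5-d114's DEGENERATE `AbsTopMonoids.degenerate` (trivial monoids).
What is certified: the typed laws of Ex 1.8 (ii)–(ix) are jointly satisfiable at a setting where (H1) is
NOT trivial (`1 ≠ Δ ≠ Π`, `G_k` infinite) — (H1) holding there by a kernel theorem ([AbsTopI] Thm 2.6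
(iv)), not by degeneracy.  Nothing here bears on [IUTchIII] Cor. 3.12; no side is taken.
-/

noncomputable section

namespace Literature.IUT.HodgeArakelov

open Literature.AnabelianGeometry.AbsoluteAnabelian
open Literature.AnabelianGeometry.SemiGraphs.SemiGraphOfAnabelioids
open Literature.AlgebraicGeometry.Frobenioids (IsSlimGroup)
open Literature.GroupTheory.CombinatorialGroupTheory

/-- **`AbsTopMonoids S` is inhabited at a profinite setting with nontrivial free pro-`Σ` `Δ` and
`G_k = G_{ℚ_p}`.**  For odd primes `l ≠ p` there is a [IUTchII] §1 setting `S` (`S.l = l`, `S.p = p`,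
bare field `k := ℂ`) whose augmented group is the profinite product extension `Δ × G_{ℚ_p} ↠ G_{ℚ_p}` with
`Δ` a pro-`{2}` completion of `Γ_{0,3}`; there `Δ ≠ 1` is slim, elastic and topologically finitely
generated, `G_k` is infinite, and the Ex 1.8 output interface `AbsTopMonoids S` is NONEMPTY ((H1) by
[AbsTopI] Thm 2.6 (iv), (H2) by compactness; degenerate monoids).  Group-theoretic model — see the
module docstring. [cite: MochizukiAbsTopI2012, Thm 2.6 (iv) p.22] -/
theorem exists_thetaSetting_nonempty_absTopMonoids (l p : ℕ) (hl : l.Prime) (hl2 : l ≠ 2)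
    (hp : p.Prime) (hp2 : p ≠ 2) (hpl : p ≠ l) :
    ∃ S : ThetaSetting.{0}, S.l = l ∧ S.p = p ∧ CompactSpace S.PiX ∧ Infinite S.Gk ∧
      S.DeltaX ≠ ⊥ ∧ IsSlimGroup S.DeltaX ∧ IsElastic S.DeltaX ∧
      IsTopologicallyFinitelyGenerated S.DeltaX ∧ Nonempty (AbsTopMonoids S) := by
  classical
  haveI : Fact p.Prime := ⟨hp⟩
  -- the product model `Δ × G_{ℚ_p} ↠ G_{ℚ_p}`, `Δ` a pro-`{2}` completion of `Γ_{0,3}`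
  obtain ⟨E, B, ι, hι⟩ :=
    FundamentalExtension.exists_mlfBase_proSigma_model p 0 3 ({2} : Set ℕ)
  have h03 : PuncturedSurfaceGroup.IsHyperbolicType 0 3 := by
    unfold PuncturedSurfaceGroup.IsHyperbolicType; norm_num
  have hS2 : ∃ ℓ ∈ ({2} : Set ℕ), ℓ.Prime := ⟨2, rfl, Nat.prime_two⟩
  have hSsub : ({2} : Set ℕ) ⊆ {q | q.Prime} := by
    rintro q rfl; exact Nat.prime_two
  have hSne : ({2} : Set ℕ) ≠ {q | q.Prime} := by
    intro h
    have h3 : (3 : ℕ) ∈ ({2} : Set ℕ) := by rw [h]; exact Nat.prime_three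
    exact absurd (Set.mem_singleton_iff.mp h3) (by norm_num)
  obtain ⟨htfg, hse, hpro⟩ :=
    FundamentalExtension.geom_props_of_isProSigmaCompletion_puncturedSurfaceGroup
      (E := E) (by norm_num) h03 hι hS2
  have hne : E.geom ≠ ⊥ :=
    E.geom_ne_bot_of_isProSigmaCompletion_puncturedSurfaceGroup hS2 (by norm_num) h03 ι hι
  -- the setting
  let S : ThetaSetting.{0} :=
    { N := 1
      l := l
      l_prime := hl
      l_odd := hl2
      p := p
      p_prime := hp
      p_odd := hp2
      p_ne_l := hpl
      k := ℂ
      hasPrimitiveRoot := ⟨Complex.exp (2 * Real.pi * Complex.I / (4 * l : ℕ)),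
        Complex.isPrimitiveRoot_exp (4 * l) (by have := hl.pos; omega)⟩
      PiX := TopGroup.of E.arith
      Gk := TopGroup.of E.gal
      aug := E.aug.toMonoidHom
      aug_continuous := E.aug.continuous
      aug_surjective := E.aug_surjective
      modelPi := TopGroup.of (Multiplicative (ZMod 1))
      modelD := ⊤
      modelD_inn := le_top
      modelD_continuous := fun _ _ =>
        ⟨continuous_of_discreteTopology, continuous_of_discreteTopology⟩
      modelTheta := ∅ }
  have hΔ : S.DeltaX = E.geom := rfl
  refine ⟨S, rfl, rfl, inferInstanceAs (CompactSpace E.arith), B.infinite_gal, ?_, ?_, ?_, ?_, ?_⟩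
  · rw [hΔ]; exact hne
  · exact hse.1
  · exact hse.2
  · exact htfg
  · exact ThetaSetting.nonempty_absTopMonoids_of_fundamentalExtension S E B htfg hSsub hSne hpro
      (ContinuousMulEquiv.refl _) (ContinuousMulEquiv.refl _) (fun _ => rfl)

end Literature.IUT.HodgeArakelov

end
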